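import Literature.AlgebraicGeometry.HodgeTheory.AbelianVarietyUniformisationPicardConverse
import Literature.AlgebraicGeometry.HodgeTheory.AbelianVarietyHodgeFullnessHolds
import Literature.AlgebraicGeometry.HodgeTheory.GAGAPicardInjective
import Literature.AlgebraicGeometry.Motives.AbelianVarietyWeilPairingRadical
import Literature.AlgebraicGeometry.Motives.AbelianVarietyProjectiveChart
import Literature.Geometry.Kaehler.ComplexTorusDualIsogenyKernelQuotient
import Literature.Geometry.Kaehler.ComplexTorusNeronSeveriEndomorphisms
import Literature.Geometry.Kaehler.ComplexTorusIsogenies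
import HarnessLib

/-!
# Every translation-invariant divisor class on a complex abelian variety is `t_a^*Θ − Θ` (Mumford §8 Thm. 1 over `ℂ`)

Layer `Literature/AlgebraicGeometry/Motives`, namespace `Literature.AlgebraicGeometry.Motives.AbelianVariety`.
For a complex abelian variety `A`, an AMPLE Cartier divisor `Θ` and a Cartier divisor `D` whose class is invariant
under all translations (`t_x^*D ∼ D` for every `x ∈ A(ℂ)`, i.e. `[D] ∈ Pic⁰`), there is a point `a ∈ A(ℂ)` with
`D ∼ t_a^*Θ − Θ` (`A.weilDiv Θ a`): the map `a ↦ [t_a^*Θ − Θ]`, `A(ℂ) → Pic⁰(A)`, is SURJECTIVE — Mumford's §8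
Theorem 1 («`Λ(L) : X → Pic⁰(X)` is surjective for `L` ample»), here over `ℂ` by the analytic theory:
* `linEquiv_of_picClass_eq` — GAGA injectivity on `Pic` in Lange's currency: equal classes `[𝒪(D)^an] = [𝒪(E)^an]` in
  `Pic(X) = H¹(Λ, H⁰(𝒪_V^*))` (`X = V/Λ ≅ A(ℂ)^an`) force `D ∼ E` (`picClass_eq_iff_analyticallyEquivalent` +
  `HodgeTheory.linEquiv_of_analyticallyEquivalent_cartierDivisorCocycle`, cell row B1);
* `phiL_eq_one_imp_mem_KTheta`, `det_intGram_ne_zero_of_isAmple` — for `Θ` ample the Néron–Severi form `H` of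
  `[𝒪(Θ)^an]` is non-degenerate: the kernel of `φ_H : X → X̂` lies over the finite group `K(Θ)`
  (`AbelianVariety.finite_KTheta`), whereas a degenerate integral form has infinite kernel
  (`ComplexTorus.infinite_ker_of_mulVec_eq_zero`);
* `exists_linEquiv_weilDiv_of_forall_translate_linEquiv_of_uniformisation` — the theorem for a GIVEN uniformisation
  `φ : V/Λ ≅ A(ℂ)`: `[𝒪(D)^an] ∈ Pic⁰ = X̂` (`picClass_cartierDivisorLineBundle_mem_picZero`), `φ_H` is onto `X̂`
  (`phiH_surjective_of_det_ne_zero`), and `φ_H(t̄) = [𝒪(t_{φ t̄}^*Θ − Θ)^an]` (`picClass_cartierDivisorLineBundle_weilDiv`);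
* `exists_linEquiv_weilDiv_of_forall_translate_linEquiv` — the uniformisation-free statement
  (`HodgeTheory.complexAbelianVariety_torusUniformised_holds`).
Purpose (cell `hodgecm-mathlib`, rung 0 on `hDel`, road (R1a)_ℂ of the J-layer: `Pic⁰` of a complex abelian variety is
swept out by `a ↦ t_a^*Θ − Θ`, the pointwise half of «`Λ(Θ) : A → Â` is an isogeny»).  Theorems only; no `def`, no
named fact, no instance.

## References
* D. Mumford, *Abelian Varieties* (1970), §8 Theorem 1 (p. 77) and §6 Application 1 (p. 60). [MumfordAV1970]
* H. Lange, *Abelian Varieties over the Complex Numbers* (2023), §1.4 Thm. 1.4.1 (Appell–Humbert), §1.4.2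
  Prop. 1.4.6, §2.2 (the map `φ_H`). [Lange2023AbelianVarietiesComplex]
-/

noncomputable section

open Set Function
open scoped Manifold ContDiff Topology
open Literature.AlgebraicGeometry.Motives Literature.Geometry.Kaehler Literature.Geometry.Kaehler.ComplexTorus
open Literature.NumberTheory.Transcendental Literature.AlgebraicGeometry.HodgeTheory

namespace Literature.AlgebraicGeometry.Motives.AbelianVariety

section Uniformised

variable (A : AbelianVariety ℂ) {ι : Type} [Fintype ι] [DecidableEq ι] {Φ : (ι → ℝ) ≃L[ℝ] (Fin A.dim → ℂ)}
  {φ : ComplexTorus Φ → ComplexPoints A.X} (hφ : IsAnalytification (Fin A.dim → ℂ) A.X A.dim φ)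
  (hadd : ∀ x y, φ (x + y) = φ x * φ y)

omit [DecidableEq ι] in
/-- **GAGA injectivity on `Pic`, in Lange's currency**: `[𝒪(D)^an] = [𝒪(E)^an]` in `Pic(X)` implies `D ∼ E`
(`picClass_eq_iff_analyticallyEquivalent` + cell row B1 `linEquiv_of_analyticallyEquivalent_cartierDivisorCocycle` for
the smooth projective `A`). [cite: Lange2023AbelianVarietiesComplex, §1.2.1 Prop. 1.2.2–1.2.3 (p. 21)]
[cite: MumfordAV1970, §6 Application 1 (p. 60)] -/
theorem linEquiv_of_picClass_eq {D E : CartierDivisor A.X.left}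
    (h : picClass (cartierDivisorLineBundle hφ D) = picClass (cartierDivisorLineBundle hφ E)) : D.LinEquiv E :=
  linEquiv_of_analyticallyEquivalent_cartierDivisorCocycle AbelianVariety.isSmoothProjective_holds hφ D E
    (analyticallyEquivalent_of_picClass_eq h)

include hφ hadd

omit [DecidableEq ι] in
/-- The kernel of the analytic `φ_{[𝒪(Θ)^an]} : X → Pic(X)` lies over `K(Θ) = {x | t_x^*Θ ∼ Θ}`.
[cite: Lange2023AbelianVarietiesComplex, §1.4.2 Prop. 1.4.6 and §2.2] [cite: MumfordAV1970, §6 Definition of `K(L)` (p. 60)] -/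
theorem phiL_eq_one_imp_mem_KTheta (Θ : CartierDivisor A.X.left) {t : ComplexTorus Φ}
    (ht : Pic.phiL (picClass (cartierDivisorLineBundle hφ Θ)) t = 1) : φ t ∈ A.KTheta Θ := by
  rw [AbelianVariety.mem_KTheta_iff]
  refine A.linEquiv_of_picClass_eq hφ ?_
  rw [picClass_cartierDivisorLineBundle_weilDiv A hφ hadd, ht, picClass_cartierDivisorLineBundle_zero hφ]

/-- **For `Θ` ample the Néron–Severi form of `[𝒪(Θ)^an]` is non-degenerate** (`det ≠ 0` of its integral Gram
matrix): the kernel of `φ_H` injects into `φ⁻¹ K(Θ)`, which is finite (`finite_KTheta`, Mumford §6 Application 1),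
while a degenerate integral form has an infinite kernel (`infinite_ker_of_mulVec_eq_zero`).
[cite: MumfordAV1970, §6 Application 1 (p. 60), §8 Theorem 1 (p. 77)] [cite: Lange2023AbelianVarietiesComplex, §2.2] -/
theorem det_intGram_ne_zero_of_isAmple {Θ : CartierDivisor A.X.left} (hΘ : Θ.IsAmple)
    (p : AHData Φ) (hp : AHData.toPic p = picClass (cartierDivisorLineBundle hφ Θ)) :
    (intGram Φ p.form).det ≠ 0 := by
  intro hdet
  set G := intGram Φ p.form with hG
  have hGmap : G.map (Int.cast : ℤ → ℝ) = latticeGram Φ p.form := map_intGram Φ p.isNSForm_form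
  -- a real null vector of `Gᵀ`
  have hdetT : (G.transpose.map (Int.cast : ℤ → ℝ)).det = 0 := by
    rw [Matrix.transpose_map, Matrix.det_transpose, ← Int.cast_det]
    exact_mod_cast hdet
  obtain ⟨v, hv0, hv⟩ := Matrix.exists_mulVec_eq_zero_iff.2 hdetT
  have hinf := infinite_ker_of_mulVec_eq_zero Φ (dualPeriod Φ) hv0 hv
  -- but the kernel of `φ_H = ρ(ᵗG)` lies in the finite set `φ⁻¹ K(Θ)`
  have hfin : ((mapMatrixHom Φ (dualPeriod Φ) G.transpose).ker : Set (ComplexTorus Φ)).Finite := by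
    refine ((A.finite_KTheta hΘ).preimage (hφ.isHomeomorph.injective.injOn)).subset fun t ht ↦ ?_
    refine A.phiL_eq_one_imp_mem_KTheta hφ hadd Θ ?_
    rw [← hp, AHData.phiL_toPic_eq_dualToPic_phiH p hGmap t, phiH_eq]
    have ht' : mapMatrix Φ (dualPeriod Φ) G.transpose t = 0 := by
      simpa [mapMatrixHom_apply] using ht
    rw [ht', dualToPic_zero]
  exact hinf.not_finite (hfin.to_subtype)

/-- **Mumford §8 Theorem 1 over `ℂ`, for a given uniformisation `φ : V/Λ ≅ A(ℂ)`**: a Cartier divisor whose class is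
translation-invariant is linearly equivalent to `t_a^*Θ − Θ` for some `a = φ t̄`, `Θ` any ample divisor
(`[𝒪(D)^an] ∈ X̂`, `φ_H` onto `X̂` as `det H ≠ 0`, `φ_H(t̄) = [𝒪(t_{φ t̄}^*Θ − Θ)^an]`, then `linEquiv_of_picClass_eq`).
[cite: MumfordAV1970, §8 Theorem 1 (p. 77)] [cite: Lange2023AbelianVarietiesComplex, §2.2 and §1.4 Thm. 1.4.1] -/
theorem exists_linEquiv_weilDiv_of_forall_translate_linEquiv_of_uniformisation
    {Θ : CartierDivisor A.X.left} (hΘ : Θ.IsAmple) (D : CartierDivisor A.X.left)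
    (hD : ∀ x : A.Points ℂ, (D.pullback (A.translation x).left).LinEquiv D) :
    ∃ a : A.Points ℂ, D.LinEquiv (A.weilDiv Θ a) := by
  obtain ⟨s, hs⟩ := exists_dualToPic_eq_picClass_cartierDivisorLineBundle A hφ hadd D hD
  obtain ⟨p, hp⟩ := AHData.toPic_surjective (picClass (cartierDivisorLineBundle hφ Θ))
  have hGmap : (intGram Φ p.form).map (Int.cast : ℤ → ℝ) = latticeGram Φ p.form := map_intGram Φ p.isNSForm_form
  obtain ⟨t, rfl⟩ := phiH_surjective_of_det_ne_zero Φ (A.det_intGram_ne_zero_of_isAmple hφ hadd hΘ p hp) s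
  refine ⟨φ t, A.linEquiv_of_picClass_eq hφ ?_⟩
  rw [picClass_cartierDivisorLineBundle_weilDiv A hφ hadd, ← hp, AHData.phiL_toPic_eq_dualToPic_phiH p hGmap t]
  exact hs.symm

end Uniformised

/-- **Mumford §8 Theorem 1 over `ℂ` (uniformisation-free)**: on a complex abelian variety, every Cartier divisor
whose class is invariant under all translations is linearly equivalent to `t_a^*Θ − Θ` for some `a ∈ A(ℂ)`, for any
ample `Θ` — the map `a ↦ [t_a^*Θ − Θ]`, `A(ℂ) → Pic⁰(A)`, is surjective.  (Uniformise by
`complexAbelianVariety_torusUniformised_holds` and apply the previous theorem.)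
[cite: MumfordAV1970, §8 Theorem 1 (p. 77)] [cite: Lange2023AbelianVarietiesComplex, §2.2] -/
theorem exists_linEquiv_weilDiv_of_forall_translate_linEquiv (A : AbelianVariety ℂ)
    {Θ : CartierDivisor A.X.left} (hΘ : Θ.IsAmple) (D : CartierDivisor A.X.left)
    (hD : ∀ x : A.Points ℂ, (D.pullback (A.translation x).left).LinEquiv D) :
    ∃ a : A.Points ℂ, D.LinEquiv (A.weilDiv Θ a) := by
  obtain ⟨ι, _, _, Φ, φ, hφ, hadd⟩ := complexAbelianVariety_torusUniformised_holds A
  exact A.exists_linEquiv_weilDiv_of_forall_translate_linEquiv_of_uniformisation hφ hadd hΘ D hD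

end Literature.AlgebraicGeometry.Motives.AbelianVariety

end
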